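import Literature.Geometry.Lorentzian.KerrSchildWaveCauchyProblem
import Literature.Geometry.Lorentzian.AdiabaticKerrSchildBackground
import Literature.Geometry.Lorentzian.MultiCentreKerrSchild

/-!
# Route ClusterCompleteness — crux `AdiabaticMultiKerrILED`: the patched coefficient field

Helper file for the crux `stmt-FinalStateConjecture-14310`
(`Summit.FinalStateConjecture.FinalStateConjecture.Theses.ClusterCompleteness.AdiabaticMultiKerrILED`).

The crux quantifies over a coefficient field `G : E4 → Fin 4 → Fin 4 → ℝ` pinned by the hypothesis
`hG : ∀ x μ ν, G x μ ν = η_{μν} − ∑ᵢ χᵢ(x) · 2Hᵢ(qᵢ x) · (Λᵢ ℓ♯ᵢ(qᵢ x))^μ (Λᵢ ℓ♯ᵢ(qᵢ x))^ν`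
(tails-cut patched multi-Kerr background: `χᵢ = smoothTransition (2 − rᵢ/8Mᵢ)`). This file records
the structural facts every line on the crux uses, stated against that literal hypothesis so that they
apply by `hG`:

* `cruxCutoff_eq_one` / `cruxCutoff_eq_zero` — the gentle step is `1` on `{rᵢ ≤ 8Mᵢ}` (exact Kerr)
  and `0` on `{16Mᵢ ≤ rᵢ}` (tails cut);
* `cruxField_symm` — `G^{μν} = G^{νμ}`;
* `cruxField_zero_zero_le` — `G⁰⁰ ≤ −1` when all `Mᵢ > 0` (lab time is a time function);
* `cruxField_eq_minkowski_of_far` — `G = η⁻¹` wherever `16Mᵢ ≤ rᵢ` for every `i`;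
* `cruxWave_eq_waveOperator` — the crux's divergence-form equation is
  `KerrSchild.waveOperator G ψ x = 0` (definitional);
* `contDiffAt_cruxField` — the components of `G` are smooth at every point where all rest-frame
  radii are positive, in particular on the exterior `{r₊ᵢ < rᵢ}`.
[folklore]
-/

noncomputable section

-- the doubled `FinalStateConjecture.FinalStateConjecture` path component trips dupNamespace
set_option linter.dupNamespace false

open scoped ContDiff Topology BigOperators
open Filter Set Literature.Geometry.Lorentzian

namespace Summit.FinalStateConjecture.FinalStateConjecture.Theorems

variable {N : ℕ}

/-! ### The gentle step `χ = smoothTransition (2 − r/8M)` -/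

/-- Inside `{r ≤ 8M}` (`M > 0`) the cut-off equals `1`: the near zone is exact Kerr. [folklore] -/
theorem cruxCutoff_eq_one {M r : ℝ} (hM : 0 < M) (hr : r ≤ 8 * M) :
    Real.smoothTransition (2 - r / (8 * M)) = 1 := by
  apply Real.smoothTransition.one_of_one_le
  have h8 : 0 < 8 * M := by positivity
  have : r / (8 * M) ≤ 1 := by rwa [div_le_one h8]
  linarith

/-- Outside `{16M ≤ r}` (`M > 0`) the cut-off vanishes: the tails are cut. [folklore] -/
theorem cruxCutoff_eq_zero {M r : ℝ} (hM : 0 < M) (hr : 16 * M ≤ r) :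
    Real.smoothTransition (2 - r / (8 * M)) = 0 := by
  apply Real.smoothTransition.zero_of_nonpos
  have h8 : 0 < 8 * M := by positivity
  have : 2 ≤ r / (8 * M) := by rw [le_div_iff₀ h8]; linarith
  linarith

/-- The cut-off takes values in `[0, 1]`. [folklore] -/
theorem cruxCutoff_nonneg (M r : ℝ) : 0 ≤ Real.smoothTransition (2 - r / (8 * M)) :=
  Real.smoothTransition.nonneg _

/-! ### The patched field -/

section Field

variable {M a : Fin N → ℝ} {Λ : Fin N → lorentzGroup} {q : Fin N → E4 → E4}
  {G : E4 → Fin 4 → Fin 4 → ℝ}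

/-- **Symmetry** `G^{μν} = G^{νμ}` of the patched field. [folklore] -/
theorem cruxField_symm
    (hG : ∀ x μ ν, G x μ ν = Minkowski.bilin (E4.basisVector μ) (E4.basisVector ν) -
      ∑ i, Real.smoothTransition (2 - Kerr.radius (a i) (q i x) / (8 * M i)) *
        (2 * Kerr.scalarH (M i) (a i) (q i x)) *
        ((Λ i : E4 ≃L[ℝ] E4) (Kerr.nullVector (a i) (q i x))) μ *
        ((Λ i : E4 ≃L[ℝ] E4) (Kerr.nullVector (a i) (q i x))) ν)
    (x : E4) (μ ν : Fin 4) : G x μ ν = G x ν μ := by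
  rw [hG, hG, Minkowski.bilin_symm]
  congr 1
  refine Finset.sum_congr rfl fun i _ ↦ ?_
  ring

/-- **`G⁰⁰ ≤ −1`**: with positive masses every Kerr–Schild term is a nonnegative multiple of a
square, so `G⁰⁰ = −1 − ∑ᵢ χᵢ 2Hᵢ ((Λᵢℓ♯ᵢ)⁰)² ≤ −1` — the lab time `x⁰` is a time function for the
patched background. [folklore] -/
theorem cruxField_zero_zero_le
    (hG : ∀ x μ ν, G x μ ν = Minkowski.bilin (E4.basisVector μ) (E4.basisVector ν) -
      ∑ i, Real.smoothTransition (2 - Kerr.radius (a i) (q i x) / (8 * M i)) *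
        (2 * Kerr.scalarH (M i) (a i) (q i x)) *
        ((Λ i : E4 ≃L[ℝ] E4) (Kerr.nullVector (a i) (q i x))) μ *
        ((Λ i : E4 ≃L[ℝ] E4) (Kerr.nullVector (a i) (q i x))) ν)
    (hM : ∀ i, 0 < M i) (x : E4) : G x 0 0 ≤ -1 := by
  rw [hG, Minkowski.bilin_basisVector_zero]
  have h : 0 ≤ ∑ i, Real.smoothTransition (2 - Kerr.radius (a i) (q i x) / (8 * M i)) *
      (2 * Kerr.scalarH (M i) (a i) (q i x)) *
      ((Λ i : E4 ≃L[ℝ] E4) (Kerr.nullVector (a i) (q i x))) 0 *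
      ((Λ i : E4 ≃L[ℝ] E4) (Kerr.nullVector (a i) (q i x))) 0 := by
    refine Finset.sum_nonneg fun i _ ↦ ?_
    have h1 := cruxCutoff_nonneg (M i) (Kerr.radius (a i) (q i x))
    have h2 : 0 ≤ 2 * Kerr.scalarH (M i) (a i) (q i x) :=
      mul_nonneg zero_le_two (Kerr.scalarH_nonneg (hM i).le _ _)
    have h3 := mul_self_nonneg (((Λ i : E4 ≃L[ℝ] E4) (Kerr.nullVector (a i) (q i x))) 0)
    calc (0 : ℝ) ≤ (Real.smoothTransition (2 - Kerr.radius (a i) (q i x) / (8 * M i)) *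
        (2 * Kerr.scalarH (M i) (a i) (q i x))) *
        (((Λ i : E4 ≃L[ℝ] E4) (Kerr.nullVector (a i) (q i x))) 0 *
        ((Λ i : E4 ≃L[ℝ] E4) (Kerr.nullVector (a i) (q i x))) 0) :=
          mul_nonneg (mul_nonneg h1 h2) h3
      _ = _ := by ring
  linarith

/-- **Exact flatness far from every hole**: where `16Mᵢ ≤ rᵢ` for all `i`, every cut-off vanishes
and `G^{μν} = η_{μν}` (`= η^{μν}` numerically). [folklore] -/
theorem cruxField_eq_minkowski_of_far
    (hG : ∀ x μ ν, G x μ ν = Minkowski.bilin (E4.basisVector μ) (E4.basisVector ν) -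
      ∑ i, Real.smoothTransition (2 - Kerr.radius (a i) (q i x) / (8 * M i)) *
        (2 * Kerr.scalarH (M i) (a i) (q i x)) *
        ((Λ i : E4 ≃L[ℝ] E4) (Kerr.nullVector (a i) (q i x))) μ *
        ((Λ i : E4 ≃L[ℝ] E4) (Kerr.nullVector (a i) (q i x))) ν)
    (hM : ∀ i, 0 < M i) {x : E4} (hfar : ∀ i, 16 * M i ≤ Kerr.radius (a i) (q i x))
    (μ ν : Fin 4) : G x μ ν = Minkowski.bilin (E4.basisVector μ) (E4.basisVector ν) := by
  rw [hG, sub_eq_self]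
  refine Finset.sum_eq_zero fun i _ ↦ ?_
  rw [cruxCutoff_eq_zero (hM i) (hfar i)]
  ring

/-- In particular, far from every hole `G^{μν}` is the Minkowski coefficient `Kerr.etaComp μ ν`
(`diag(−1, 1, 1, 1)`). [folklore] -/
theorem cruxField_eq_etaComp_of_far
    (hG : ∀ x μ ν, G x μ ν = Minkowski.bilin (E4.basisVector μ) (E4.basisVector ν) -
      ∑ i, Real.smoothTransition (2 - Kerr.radius (a i) (q i x) / (8 * M i)) *
        (2 * Kerr.scalarH (M i) (a i) (q i x)) *
        ((Λ i : E4 ≃L[ℝ] E4) (Kerr.nullVector (a i) (q i x))) μ *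
        ((Λ i : E4 ≃L[ℝ] E4) (Kerr.nullVector (a i) (q i x))) ν)
    (hM : ∀ i, 0 < M i) {x : E4} (hfar : ∀ i, 16 * M i ≤ Kerr.radius (a i) (q i x))
    (μ ν : Fin 4) : G x μ ν = Kerr.etaComp μ ν := by
  rw [cruxField_eq_minkowski_of_far hG hM hfar, Kerr.etaComp]
  fin_cases μ <;> fin_cases ν <;> simp [Fin.sum_univ_three, Fin.succ_ne_zero]

/-- **The crux's equation is the divergence-form wave equation** `□_G ψ = 0` of
`KerrSchild.waveOperator` (definitional unfolding). [folklore] -/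
theorem cruxWave_eq_waveOperator (G : E4 → Fin 4 → Fin 4 → ℝ) (ψ : E4 → ℝ) (x : E4) :
    (∑ μ : Fin 4, fderiv ℝ (fun y ↦ ∑ ν : Fin 4, G y μ ν * fderiv ℝ ψ y (E4.basisVector ν)) x
        (E4.basisVector μ)) = KerrSchild.waveOperator G ψ x := rfl

/-! ### Smoothness of the patched field off the rings -/

/-- One Kerr–Schild term `x ↦ χ(r(qx)) · 2H(qx) · (Λ ℓ♯(qx))^μ (Λ ℓ♯(qx))^ν` of the patched field is
`C^n` at every point whose rest-frame radius is positive (`q = poincareInv Λ c` affine; `r`, `H`,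
`ℓ♯` real-analytic off the ring; `smoothTransition` smooth). [folklore] -/
theorem contDiffAt_cruxTerm (Mi ai : ℝ) (Λi : lorentzGroup) (c : E4) {x : E4}
    (hx : 0 < Kerr.radius ai (poincareInv Λi c x)) (μ ν : Fin 4) {n : ℕ∞} :
    ContDiffAt ℝ n (fun y ↦
      Real.smoothTransition (2 - Kerr.radius ai (poincareInv Λi c y) / (8 * Mi)) *
        (2 * Kerr.scalarH Mi ai (poincareInv Λi c y)) *
        ((Λi : E4 ≃L[ℝ] E4) (Kerr.nullVector ai (poincareInv Λi c y))) μ *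
        ((Λi : E4 ≃L[ℝ] E4) (Kerr.nullVector ai (poincareInv Λi c y))) ν) x := by
  have hq : ContDiffAt ℝ (n : WithTop ℕ∞) (poincareInv Λi c) x :=
    (contDiff_poincareInv Λi c).contDiffAt
  have hr : ContDiffAt ℝ (n : WithTop ℕ∞) (fun y ↦ Kerr.radius ai (poincareInv Λi c y)) x :=
    Kerr.contDiffAt_radius_comp contDiffAt_const hq hx
  have hH : ContDiffAt ℝ (n : WithTop ℕ∞) (fun y ↦ Kerr.scalarH Mi ai (poincareInv Λi c y)) x :=
    Kerr.contDiffAt_scalarH_comp contDiffAt_const contDiffAt_const hq hx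
  have hl : ContDiffAt ℝ (n : WithTop ℕ∞) (fun y ↦ Kerr.nullVector ai (poincareInv Λi c y)) x :=
    Kerr.contDiffAt_nullVector_comp contDiffAt_const hq hx
  have hΛl : ContDiffAt ℝ (n : WithTop ℕ∞)
      (fun y ↦ (Λi : E4 ≃L[ℝ] E4) (Kerr.nullVector ai (poincareInv Λi c y))) x :=
    ((Λi : E4 ≃L[ℝ] E4) : E4 →L[ℝ] E4).contDiff.contDiffAt.comp x hl
  have hcomp : ∀ κ : Fin 4, ContDiffAt ℝ (n : WithTop ℕ∞)
      (fun y ↦ ((Λi : E4 ≃L[ℝ] E4) (Kerr.nullVector ai (poincareInv Λi c y))) κ) x :=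
    contDiffAt_euclidean.mp hΛl
  have hχ : ContDiffAt ℝ (n : WithTop ℕ∞)
      (fun y ↦ Real.smoothTransition (2 - Kerr.radius ai (poincareInv Λi c y) / (8 * Mi))) x :=
    Real.smoothTransition.contDiff.contDiffAt.comp x (contDiffAt_const.sub (hr.div_const _))
  exact ((hχ.mul (contDiffAt_const.mul hH)).mul (hcomp μ)).mul (hcomp ν)

/-- **Smoothness of the patched field**: under the crux hypothesis `qᵢ = poincareInv Λᵢ (0, pᵢ)`,
every component `y ↦ G y μ ν` is `C^n` at each point all of whose rest-frame radii are
positive — in particular at every point of the exterior `{r₊ᵢ < rᵢ}` (where `r₊ᵢ ≥ Mᵢ > 0`).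
[folklore] -/
theorem contDiffAt_cruxField {p : Fin N → E3}
    (hq : ∀ i x, q i x = poincareInv (Λ i) (E4.ofTimeSpace 0 (p i)) x)
    (hG : ∀ x μ ν, G x μ ν = Minkowski.bilin (E4.basisVector μ) (E4.basisVector ν) -
      ∑ i, Real.smoothTransition (2 - Kerr.radius (a i) (q i x) / (8 * M i)) *
        (2 * Kerr.scalarH (M i) (a i) (q i x)) *
        ((Λ i : E4 ≃L[ℝ] E4) (Kerr.nullVector (a i) (q i x))) μ *
        ((Λ i : E4 ≃L[ℝ] E4) (Kerr.nullVector (a i) (q i x))) ν)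
    {x : E4} (hx : ∀ i, 0 < Kerr.radius (a i) (q i x)) (μ ν : Fin 4) {n : ℕ∞} :
    ContDiffAt ℝ n (fun y ↦ G y μ ν) x := by
  have hfun : (fun y ↦ G y μ ν) = fun y ↦ Minkowski.bilin (E4.basisVector μ) (E4.basisVector ν) -
      ∑ i, Real.smoothTransition (2 - Kerr.radius (a i) (poincareInv (Λ i)
          (E4.ofTimeSpace 0 (p i)) y) / (8 * M i)) *
        (2 * Kerr.scalarH (M i) (a i) (poincareInv (Λ i) (E4.ofTimeSpace 0 (p i)) y)) *
        ((Λ i : E4 ≃L[ℝ] E4) (Kerr.nullVector (a i)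
          (poincareInv (Λ i) (E4.ofTimeSpace 0 (p i)) y))) μ *
        ((Λ i : E4 ≃L[ℝ] E4) (Kerr.nullVector (a i)
          (poincareInv (Λ i) (E4.ofTimeSpace 0 (p i)) y))) ν := by
    funext y
    rw [hG]
    simp only [hq]
  rw [hfun]
  refine contDiffAt_const.sub (ContDiffAt.sum fun i _ ↦ ?_)
  have hxi : 0 < Kerr.radius (a i) (poincareInv (Λ i) (E4.ofTimeSpace 0 (p i)) x) := by
    rw [← hq]; exact hx i
  exact contDiffAt_cruxTerm (M i) (a i) (Λ i) _ hxi μ ν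

/-- On the exterior all rest-frame radii are positive: `r₊(M, a) ≥ M > 0` for `M > 0` (also for
the junk value `r₊ = M` when `|a| > M`). [folklore] -/
theorem radius_pos_of_rPlus_lt {Mi ai : ℝ} (hMi : 0 < Mi) {z : E4}
    (hz : Kerr.rPlus Mi ai < Kerr.radius ai z) : 0 < Kerr.radius ai z := by
  refine lt_trans ?_ hz
  unfold Kerr.rPlus
  have := Real.sqrt_nonneg (Mi ^ 2 - ai ^ 2)
  linarith

/-- **Smoothness on the exterior**: at every point of `{∀ i, r₊ᵢ < rᵢ}` the components of the
patched field are `C^∞`. [folklore] -/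
theorem contDiffAt_cruxField_of_exterior {p : Fin N → E3}
    (hq : ∀ i x, q i x = poincareInv (Λ i) (E4.ofTimeSpace 0 (p i)) x) (hM : ∀ i, 0 < M i)
    (hG : ∀ x μ ν, G x μ ν = Minkowski.bilin (E4.basisVector μ) (E4.basisVector ν) -
      ∑ i, Real.smoothTransition (2 - Kerr.radius (a i) (q i x) / (8 * M i)) *
        (2 * Kerr.scalarH (M i) (a i) (q i x)) *
        ((Λ i : E4 ≃L[ℝ] E4) (Kerr.nullVector (a i) (q i x))) μ *
        ((Λ i : E4 ≃L[ℝ] E4) (Kerr.nullVector (a i) (q i x))) ν)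
    {x : E4} (hx : ∀ i, Kerr.rPlus (M i) (a i) < Kerr.radius (a i) (q i x)) (μ ν : Fin 4) :
    ContDiffAt ℝ ∞ (fun y ↦ G y μ ν) x :=
  contDiffAt_cruxField hq hG (fun i ↦ radius_pos_of_rPlus_lt (hM i) (hx i)) μ ν

end Field

end Summit.FinalStateConjecture.FinalStateConjecture.Theorems

end
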